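import Summits.ResolutionOfSingularities.ResolutionOfSingularities.Theorems.FrobeniusLadderFRationalResolutionFixedPointKatoIdeal
import Summits.ResolutionOfSingularities.ResolutionOfSingularities.Theorems.FrobeniusLadderFRationalResolutionFixedPointDimension
import Summits.ResolutionOfSingularities.ResolutionOfSingularities.Theorems.FrobeniusLadderFRationalResolutionFixedPointGenerators
import Literature.AlgebraicGeometry.Resolution.LogRegularResolution
import Mathlib.Algebra.Order.Monoid.Submonoid
import Mathlib.Algebra.Group.Submonoid.Finsupp
import Mathlib.RingTheory.KrullDimension.Field
import Mathlib.LinearAlgebra.Dimension.Finite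
import HarnessLib

/-!
# Crux `FrobeniusLadder.FRationalResolution` (stmt-ResolutionOfSingularities-15317), line `redirect`,
# stub `stub_diagonalizableQuotientResolution` — **the quotient chart `Spec S₀` is KATO-LOG-REGULAR at the
# image of every `D(A)`-fixed point**, for the monomial chart of a homogeneous regular system of
# parameters (linearisation step L3, brick 8 = assembly of bricks 1–7)

Let `S` be a REGULAR algebra of finite type over a field graded by a torsion abelian group `A`
(`GradedAlgebra 𝒮`, `S₀ = 𝒮 0`; an action of the diagonalizable group scheme `D(A)`), `𝔔 ⊇ S_a`
(`a ≠ 0`) a prime (a `D(A)`-fixed point) and `𝔮 = 𝔔 ∩ S₀`. By `…FixedPointGenerators` there are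
homogeneous `x₁,…,x_n ∈ 𝔔`, `n = dim S_𝔔`, of degrees `a₁,…,a_n`, generating `𝔔 S_𝔔`. Let
`M = {m ∈ ℕⁿ : Σ mᵢ aᵢ = 0}` (`= ℕⁿ ∩ ker(ℤⁿ → A)`, a fine saturated monoid with `rank Mᵍᵖ = n`) and
`φ : M → S₀`, `m ↦ x^m`. Then `(Spec S₀, M)` satisfies Kato's regularity condition (2.1) at `𝔮`
(`LogChart.IsLogRegularAt M φ 𝔮` of the tree): (i) `(S₀)_𝔮 / I(𝔮) = κ(𝔮)` is regular, because
`𝔮 (S₀)_𝔮` is generated by the degree-`0` monomials lying in `𝔔` (`…FixedPointKatoIdeal`), all of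
which are `φ(m)`, `m ∈ M ∖ 0`; (ii) `dim (S₀)_𝔮 = dim S_𝔔 = n` (`…FixedPointDimension`) `= 0 + (n − 0)`,
the face of the chart at `𝔮` being `{0}`.

* `exists_isLogRegularAt_of_fixed` — the statement above, with the chart exhibited
  (`P = ℤⁿ_{≥0} ⊓ ker (m ↦ Σ mᵢ aᵢ)`, `φ(m) = ∏ xᵢ^{mᵢ}`).

Honest label: a MILESTONE of L3, not the stub: log-regularity is proved at FIXED points only and
for the local chart there; the non-fixed points (reduction to the stabiliser grading `A/B`,
inseparable `D(B)`-torsors when `p ∣ |B|`), the generization/openness of log-regularity, the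
compatibility of the charts on overlaps (`EtaleLogAtlas.chart_compatible`) and the spanning
reparametrisation `Mᵍᵖ ≅ ℤⁿ` remain before the tree's PROVED Nizioł/Kato resolution of log regular
schemes applies. No definitions, no named facts, no sorry.
[cite: Kato1994, Def. (2.1)] [folklore; cite: SGA3, Exp. VIII §4–5]
-/

noncomputable section

-- single-problem summit: the doubled namespace component is forced
set_option linter.dupNamespace false

open IsLocalRing
open Literature.AlgebraicGeometry.Resolution
open Literature.AlgebraicGeometry.Resolution.DiagonalizableQuotient

namespace Summit.ResolutionOfSingularities.ResolutionOfSingularities.Theorems.FRationalResolution.FixedPointLogRegular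

universe u w

variable {k : Type u} [Field k] {A : Type w} [DecidableEq A] [AddCommGroup A] {S : Type u}
  [CommRing S] [Algebra k S] (𝒮 : A → Submodule k S) [GradedAlgebra 𝒮]

/-- The monomial in `x` with exponent `m ∈ ℤⁿ_{≥0}` is homogeneous of degree `Σ mᵢ aᵢ`. [folklore] -/
theorem prod_pow_toNat_mem {n : ℕ} (x : Fin n → S) (a : Fin n → A) (hx : ∀ i, x i ∈ 𝒮 (a i))
    (m : Fin n → ℤ) (hm : 0 ≤ m) :
    ∏ i, x i ^ (m i).toNat ∈ 𝒮 (Fintype.linearCombination ℤ a m) := by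
  have h := SetLike.prod_pow_mem_graded 𝒮 a x (F := Finset.univ) (fun i => (m i).toNat)
    fun i _ => hx i
  rw [Fintype.linearCombination_apply]
  -- `m i • a i = (m i).toNat • a i` since `0 ≤ m i`
  have hsum : ∑ i, m i • a i = ∑ i, (m i).toNat • a i :=
    Finset.sum_congr rfl fun i _ => by rw [← natCast_zsmul, Int.toNat_of_nonneg (hm i)]
  rw [hsum]
  exact h

/-- **The quotient chart is Kato-log-regular at every fixed point.** `S` regular of finite type over a
field, graded by a torsion group; `𝔔` a prime containing every `S_a`, `a ≠ 0`. There are homogeneous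
`x₁,…,x_n ∈ 𝔔` (`n = dim S_𝔔`) of degrees `aᵢ` such that, for the monoid
`P = {m ∈ ℤⁿ : m ≥ 0, Σ mᵢ aᵢ = 0}` and the chart `φ(m) = x^m ∈ S₀`, Kato's condition (2.1) holds at
`𝔮 = 𝔔 ∩ S₀`: `LogChart.IsLogRegularAt P φ 𝔮`. [cite: Kato1994, Def. (2.1)] -/
theorem exists_isLogRegularAt_of_fixed [IsRegularRing S] [Algebra.FiniteType k S]
    (hA : AddMonoid.IsTorsion A) (𝔔 : Ideal S) [𝔔.IsPrime]
    (hfix : ∀ a : A, a ≠ 0 → ∀ s ∈ 𝒮 a, s ∈ 𝔔) :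
    ∃ (n : ℕ) (x : Fin n → S) (a : Fin n → A),
      (∀ i, x i ∈ 𝔔 ∧ x i ∈ 𝒮 (a i)) ∧ (n : WithBot ℕ∞) = ringKrullDim (Localization.AtPrime 𝔔) ∧
      ∃ φ : Multiplicative ↥(AddSubmonoid.nonneg (Fin n → ℤ) ⊓
          AddMonoidHom.mker (Fintype.linearCombination ℤ a).toAddMonoidHom) →* 𝒮 0,
        (∀ p, ((φ (Multiplicative.ofAdd p) : 𝒮 0) : S) = ∏ i, x i ^ ((p : Fin n → ℤ) i).toNat) ∧
        LogChart.IsLogRegularAt _ φ (𝔔.comap (algebraMap (𝒮 0) S)) := by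
  classical
  -- brick 1: a homogeneous regular system of parameters
  obtain ⟨t, hthom, htspan, htcard⟩ :=
    FixedPointGenerators.exists_homogeneous_regularParameters_of_fixed 𝒮 𝔔 hfix
  set n := t.card with hn
  let x : Fin n → S := fun i => (t.equivFin.symm i : S)
  choose a ha using fun i : Fin n => (hthom _ (t.equivFin.symm i).2).2
  have hx𝔔 : ∀ i, x i ∈ 𝔔 := fun i => (hthom _ (t.equivFin.symm i).2).1
  refine ⟨n, x, a, fun i => ⟨hx𝔔 i, ha i⟩, htcard, ?_⟩
  -- the chart
  set P : AddSubmonoid (Fin n → ℤ) := AddSubmonoid.nonneg (Fin n → ℤ) ⊓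
    AddMonoidHom.mker (Fintype.linearCombination ℤ a).toAddMonoidHom with hP
  have hPnonneg : ∀ p : P, (0 : Fin n → ℤ) ≤ (p : Fin n → ℤ) := fun p =>
    (AddSubmonoid.mem_nonneg.mp (AddSubmonoid.mem_inf.mp p.2).1)
  have hPdeg : ∀ p : P, Fintype.linearCombination ℤ a (p : Fin n → ℤ) = 0 := fun p =>
    (AddMonoidHom.mem_mker).mp (AddSubmonoid.mem_inf.mp p.2).2
  have hmem : ∀ p : P, ∏ i, x i ^ ((p : Fin n → ℤ) i).toNat ∈ 𝒮 0 := fun p => by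
    have h := prod_pow_toNat_mem 𝒮 x a ha (p : Fin n → ℤ) (hPnonneg p)
    rwa [hPdeg p] at h
  let φ : Multiplicative P →* 𝒮 0 :=
    { toFun := fun p => ⟨∏ i, x i ^ ((p.toAdd : Fin n → ℤ) i).toNat, hmem p.toAdd⟩
      map_one' := Subtype.ext (by simp)
      map_mul' := fun p q => Subtype.ext (by
        change ∏ i, x i ^ (((p.toAdd : Fin n → ℤ) + (q.toAdd : Fin n → ℤ)) i).toNat =
          (∏ i, x i ^ ((p.toAdd : Fin n → ℤ) i).toNat) * ∏ i, x i ^ ((q.toAdd : Fin n → ℤ) i).toNat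
        rw [← Finset.prod_mul_distrib]
        refine Finset.prod_congr rfl fun i _ => ?_
        rw [← pow_add, Pi.add_apply, Int.toNat_add (hPnonneg p.toAdd i) (hPnonneg q.toAdd i)]) }
  have hφ : ∀ p : P, ((φ (Multiplicative.ofAdd p) : 𝒮 0) : S) = ∏ i, x i ^ ((p : Fin n → ℤ) i).toNat :=
    fun p => rfl
  refine ⟨φ, hφ, ?_⟩
  -- notation for the base local ring
  set 𝔮 : Ideal (𝒮 0) := 𝔔.comap (algebraMap (𝒮 0) S) with h𝔮
  have hrange : (↑t : Set S) = Set.range x := by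
    ext s
    constructor
    · intro hs
      exact ⟨t.equivFin ⟨s, hs⟩, by simp [x]⟩
    · rintro ⟨i, rfl⟩
      exact (t.equivFin.symm i).2
  -- (a) Kato's ideal extends to the maximal ideal of `(S₀)_𝔮`
  have hImap : (LogChart.ideal P φ 𝔮).map (algebraMap (𝒮 0) (Localization.AtPrime 𝔮)) =
      maximalIdeal (Localization.AtPrime 𝔮) := by
    apply le_antisymm
    · rw [← Localization.AtPrime.map_eq_maximalIdeal]
      exact Ideal.map_mono (LogChart.ideal_le P φ 𝔮)
    · rw [FixedPointKatoIdeal.maximalIdeal_eq_span_monomials_of_fixed 𝒮 hA 𝔔 hfix t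
        (fun s hs => (hthom s hs).2) htspan (Localization.AtPrime 𝔮), ← Ideal.map_span]
      refine Ideal.map_mono (Ideal.span_le.mpr ?_)
      rintro g ⟨hg𝔔, hgcl⟩
      rw [hrange] at hgcl
      obtain ⟨e, he⟩ := Submonoid.mem_closure_range_iff_of_fintype.mp hgcl
      have henn : (0 : Fin n → ℤ) ≤ fun i => (e i : ℤ) := fun i => by positivity
      have hprod : ∏ i, x i ^ ((fun i => (e i : ℤ)) i).toNat = (g : S) := by
        rw [he]
        exact Finset.prod_congr rfl fun i _ => by simp only [Int.toNat_natCast]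
      by_cases hdeg : Fintype.linearCombination ℤ a (fun i => (e i : ℤ)) = 0
      · have hpP : (fun i => (e i : ℤ)) ∈ P :=
          AddSubmonoid.mem_inf.mpr ⟨AddSubmonoid.mem_nonneg.mpr henn, AddMonoidHom.mem_mker.mpr hdeg⟩
        have hφp : φ (Multiplicative.ofAdd ⟨_, hpP⟩) = g := Subtype.ext (by rw [hφ]; exact hprod)
        refine Ideal.subset_span ⟨⟨_, hpP⟩, ?_, hφp⟩
        change φ (Multiplicative.ofAdd ⟨_, hpP⟩) ∈ 𝔮
        rw [hφp]
        exact hg𝔔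
      · -- a monomial of non-zero degree lying in `S₀` vanishes
        have hgd : (g : S) ∈ 𝒮 (Fintype.linearCombination ℤ a fun i => (e i : ℤ)) := by
          rw [← hprod]
          exact prod_pow_toNat_mem 𝒮 x a ha _ henn
        have hg0 : (g : S) = 0 := by
          have h1 := DirectSum.decompose_of_mem_ne 𝒮 hgd hdeg
          rwa [DirectSum.decompose_of_mem_same 𝒮 g.2] at h1
        have hg0' : g = 0 := Subtype.ext hg0
        rw [hg0']
        exact Ideal.zero_mem _
  -- (b) the quotient by Kato's ideal is the residue field: regular of dimension `0`
  have hres0 : ringKrullDim (ResidueField (Localization.AtPrime 𝔮)) = 0 :=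
    ringKrullDim_eq_zero_of_field _
  -- (c) the face of the chart at `𝔮` is `{0}`
  have hface : (fun p : P => (p : Fin n → ℤ)) '' LogChart.face P φ 𝔮 = {0} := by
    ext v
    simp only [Set.mem_image, LogChart.mem_face_iff, Set.mem_singleton_iff]
    constructor
    · rintro ⟨p, hp, rfl⟩
      by_contra hv
      apply hp
      obtain ⟨i, hi⟩ : ∃ i, (p : Fin n → ℤ) i ≠ 0 := by
        by_contra hall
        push Not at hall
        exact hv (funext hall)
      have h0 : (0 : ℤ) ≤ (p : Fin n → ℤ) i := hPnonneg p i
      have hlt : (0 : ℤ) < (p : Fin n → ℤ) i := lt_of_le_of_ne h0 (Ne.symm hi)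
      have hpos : 1 ≤ ((p : Fin n → ℤ) i).toNat := by omega
      change ((φ (Multiplicative.ofAdd p) : 𝒮 0) : S) ∈ 𝔔
      rw [hφ, ← Finset.mul_prod_erase Finset.univ _ (Finset.mem_univ i)]
      exact Ideal.mul_mem_right _ _ (Ideal.pow_mem_of_mem 𝔔 (hx𝔔 i) _ hpos)
    · rintro rfl
      refine ⟨0, ?_, rfl⟩
      change ((φ (Multiplicative.ofAdd (0 : P)) : 𝒮 0) : S) ∉ 𝔔
      rw [ofAdd_zero, map_one]
      exact fun h1 => (inferInstance : 𝔔.IsPrime).ne_top ((Ideal.eq_top_iff_one 𝔔).mpr h1)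
  have hrank : Module.finrank ℤ
      (Submodule.span ℤ ((fun p : P => (p : Fin n → ℤ)) '' LogChart.face P φ 𝔮)) = 0 := by
    rw [hface, Submodule.span_zero_singleton, finrank_bot]
  -- (d) `dim (S₀)_𝔮 = dim S_𝔔 = n`
  letI : Algebra (Localization.AtPrime 𝔮) (Localization.AtPrime 𝔔) :=
    (Localization.localRingHom 𝔮 𝔔 (algebraMap (𝒮 0) S) rfl).toAlgebra
  haveI : IsScalarTower (𝒮 0) (Localization.AtPrime 𝔮) (Localization.AtPrime 𝔔) :=
    IsScalarTower.of_algebraMap_eq fun r => by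
      rw [IsScalarTower.algebraMap_apply (𝒮 0) S (Localization.AtPrime 𝔔)]
      exact (Localization.localRingHom_to_map 𝔮 𝔔 (algebraMap (𝒮 0) S) rfl r).symm
  have hdimR : ringKrullDim (Localization.AtPrime 𝔮) = n := by
    rw [FixedPointDimension.ringKrullDim_atPrime_eq_of_fixed 𝒮 hA 𝔔 hfix
      (Localization.AtPrime 𝔮) (Localization.AtPrime 𝔔), ← htcard]
  -- (e) assemble Kato's (2.1)
  constructor
  · exact IsRegularLocalRing.of_ringEquiv (R := ResidueField (Localization.AtPrime 𝔮))
      (Ideal.quotEquivOfEq hImap).symm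
  · -- the two `CommSemiring` structures on `S₀` (grade-zero semiring / ring) are only
    -- definitionally equal: close the instance-laden goal with `convert`
    have hgoal : ringKrullDim (Localization.AtPrime 𝔮) =
        ringKrullDim (ResidueField (Localization.AtPrime 𝔮)) + ((n - 0 : ℕ) : WithBot ℕ∞) := by
      rw [hres0, hdimR, Nat.sub_zero, zero_add]
    convert hgoal using 2
    · exact ringKrullDim_eq_of_ringEquiv (Ideal.quotEquivOfEq hImap)
    · rw [hrank]

end Summit.ResolutionOfSingularities.ResolutionOfSingularities.Theorems.FRationalResolution.FixedPointLogRegular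

end
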